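import Mathlib
import Literature.MathematicalPhysics.QuantumFieldTheory.Balaban1983to89.B5Hk103Unique

/-!
# Bałaban [B5] p. 29 — `H B` is THE minimiser (in the ℓ²-difference class) of the Dirichlet energy on the
# hyperplane `{A : Q A = B}`: the GLOBAL variational characterisation of the scalar operator `H` on the lattice `ℤ^d`

**Sources (verbatim; the quotations LOCATE the object — nothing printed is used as a hypothesis).**

* [B5] T. Bałaban, *Propagators and renormalization transformations for lattice gauge theories. I*, Commun. Math.
  Phys. **95** (1984) 17–40 [`Balaban1984PropagatorsI`], p. 29 [PDF 13] (render
  `1984-cmp95-propagators-rt-I-p013-x2.png`, read as an image by this unit): «Using (1.60), or better (1.63), we can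
  verify all the properties of H_kB: Q_kH_kB = B, R∂*H_kB = 0, H_kB is a minimum of ½⟨∂A, ∂A⟩ on the hyperplane
  {A : Q_kA = B, R∂*A = 0}, which means that ⟨∂A′, ∂H_kB⟩ = 0 on the subspace {A′ : Q_kA′ = 0, R∂*A′ = 0}.»; the
  representation `H_kB = GQ*(QGQ*)⁻¹B` is (1.103) p. 34 [PDF 18] (render `…-p018-x2.png`), kernel-certified in the
  scalar whole-lattice case by `B5Hk103ScalarZd` (`kerH`), with uniqueness / `a`-independence in `B5Hk103Unique`.

**What this module proves (KERNEL, hypothesis-free; scalar case `U = 1`; site coordinates on `ℤ^d`, mesh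
`η = 1/(n+1)` with `n : ℕ` ARBITRARY, `a > 0`).**  `B5Hk103ScalarZd` §8 certified only LOCAL minimality
(`energy_kerH_le`: finitely supported competitors' perturbations, bond windows).  Here, for a finitely supported coarse
field `B` (support in a finset `T`) and `HB := Σ_{y∈T} B(y) H(·,y)`:

* `sum_B_HB` (`Q'(HB) = B`) and `summable_HB_sq` (`HB ∈ ℓ²(ℤ^d)`);
* `energy_eq_add` — PYTHAGORAS: for every competitor `A` with `Q'A = B` whose difference `A − HB` is
  square-summable, `energy A = energy HB + energy (A − HB)`, where `energy A = Σ_μ Σ_p (A(p) − A(p + e_μ))²` is the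
  Dirichlet form in site units; mechanism: the polarised `ℓ²` summation by parts `Σ_μ⟨∇_μf, ∇_μD⟩ = ⟨(−Δ)f, D⟩`
  (`tsum_lapRow_mul₂`), the Euler–Lagrange identity of `B5Hk103ScalarZd.tsum_lap_mul_kerH` (`Δ HB` is constant on
  blocks, `lapRow_HB`) and `Q'(A − HB) = 0` block by block (`tsum_lapRow_HB_mul_eq_zero`);
* `energy_HB_le` — GLOBAL MINIMALITY `energy HB ≤ energy A` on that class, and `eq_HB_of_energy_eq` — UNIQUENESS OF
  THE MINIMISER: `energy A = energy HB` forces `A = HB` (a zero-energy square-summable field is invariant under the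
  unit shifts, hence zero: `eq_zero_of_shift_eq`).
* `weakEL_HB`, `eq_HB_of_weakEL` — the Euler–Lagrange form: `HB` satisfies the weak Euler–Lagrange equation of
  `B5Hk103Unique.WeakEL` and is the UNIQUE square-summable field with `Q'K = B` doing so («which means that
  ⟨∂A′, ∂H_kB⟩ = 0 on the subspace {A′ : Q_kA′ = 0, …}»).

DICTIONARY (as in `B5Hk103ScalarZd` / `B5Hk103Unique`, honest): fine field `A : ℤ^d → ℝ` in SITE coordinates;
`Q'A(y) = (n+1)^{−d}Σ_{p∈B(y)}A(p)` so that `Q'A = B` reads `Σ_{p∈B(y)}A(p) = (n+1)^d B(y)`; the print's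
`⟨∂A, ∂A⟩ = Σ_{bonds} η^d (η^{−1}(A(p+e_μ) − A(p)))² = η^{d−2}·energy A` — a positive constant multiple, so «minimum of
½⟨∂A, ∂A⟩» and «minimum of `energy`» on the same hyperplane are the same statement.

HONEST SCOPE.  (i) SCALAR analogue only (no gauge condition `R∂*A = 0`, plain block averaging), as in the two parent
modules; (ii) WHOLE lattice `ℤ^d`, not the torus `T_η` (where the hyperplane is finite-dimensional and no class
restriction arises); (iii) competitors are taken in the `ℓ²`-DIFFERENCE CLASS `{A : Q'A = B, A − HB ∈ ℓ²(ℤ^d)}` — the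
class in which `B5Hk103Unique` proves uniqueness; finite-energy competitors whose difference from `HB` is not
square-summable are NOT treated; (iv) `B` finitely supported.

ABSOLUTE-RULE CENSUS: every theorem below is proved outright from the tree modules `B5Hk103Unique`, `B5Hk103ScalarZd`
(and through them `B6QGQDecay237`, `B6QGQLower276`) and Mathlib (sorry-free; axioms `propext`, `Classical.choice`,
`Quot.sound` only); no quoted statement is used as a hypothesis.  Unit `b2b-balaban-pv23-g7` (surge node prover #23,
gen 7; journal claim B5-103-HK-SCALAR-ZD-GLOBALMIN); value = kernel discharge (the global form of the printed
variational property, scalar, WALL v2.2 §9 row «B5 (1.99)–(1.103)» column (O1′-id) «EL»), NOT summit progress.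
-/

namespace Literature.MathematicalPhysics.QuantumFieldTheory.Balaban1983to89.B5Hk103Minimizer

open Finset Real Filter Topology
open B6QGQLower276 B6QGQDecay237 B5Hk103ScalarZd B5Hk103Unique

noncomputable section

variable {d : ℕ}

/-! ## §1  The objects [folklore dictionary] -/

/-- The Dirichlet energy in site units: `energy A = Σ_μ Σ_p (A(p) − A(p + e_μ))²` (`= η^{2−d}⟨∂A, ∂A⟩`; as a `tsum`
it is the true energy whenever each directional gradient is square-summable, in particular on the `ℓ²`-difference
class below). [folklore] -/
def energy (A : X d → ℝ) : ℝ := ∑ μ : Fin d, ∑' p, (A p - A (p + e μ)) ^ 2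

/-- `HB = Σ_{y∈T} B(y) H(·,y)` — the scalar operator `H = G'Q'*(Q'G'Q'*)⁻¹` of (1.103) applied to a coarse field `B`
supported in the finset `T`. [cite: Balaban1984PropagatorsI, (1.103) p.34] -/
def HB (n : ℕ) (a : ℝ) (T : Finset (X d)) (Bf : X d → ℝ) (p : X d) : ℝ := ∑ y ∈ T, Bf y * kerH n a p y

/-! ## §2  `ℓ²` bookkeeping [folklore] -/

/-- Square-summability is preserved under sums (`(f+g)² ≤ 2f² + 2g²`). [folklore] -/
theorem summable_sq_add {f g : X d → ℝ} (hf : Summable fun p => f p ^ 2) (hg : Summable fun p => g p ^ 2) :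
    Summable fun p => (f p + g p) ^ 2 := by
  refine Summable.of_norm_bounded ((hf.mul_left 2).add (hg.mul_left 2)) fun p => ?_
  rw [Real.norm_eq_abs, abs_of_nonneg (sq_nonneg _)]
  nlinarith [sq_nonneg (f p - g p)]

/-- Square-summability is preserved under differences. [folklore] -/
theorem summable_sq_sub {f g : X d → ℝ} (hf : Summable fun p => f p ^ 2) (hg : Summable fun p => g p ^ 2) :
    Summable fun p => (f p - g p) ^ 2 := by
  have := summable_sq_add hf (show Summable fun p => (-g p) ^ 2 by simpa using hg)
  simpa [sub_eq_add_neg] using this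

/-- Square-summability is preserved under scalar multiples. [folklore] -/
theorem summable_sq_smul {f : X d → ℝ} (c : ℝ) (hf : Summable fun p => f p ^ 2) :
    Summable fun p => (c * f p) ^ 2 := by
  simpa [mul_pow] using hf.mul_left (c ^ 2)

/-- The directional gradient of a square-summable field is square-summable. [folklore] -/
theorem summable_grad_sq {f : X d → ℝ} (hf : Summable fun p => f p ^ 2) (μ : Fin d) :
    Summable fun p => (f p - f (p + e μ)) ^ 2 :=
  summable_sq_sub hf (summable_sq_shift hf (e μ))

/-! ## §3  Polarised `ℓ²` summation by parts: `Σ_μ ⟨∇_μ f, ∇_μ D⟩ = ⟨(−Δ)f, D⟩` [folklore] -/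

/-- `p ↦ ((−Δ)f)(p)·D(p)` is summable for square-summable `f`, `D`. [folklore] -/
theorem summable_lapRow_mul₂ {f D : X d → ℝ} (hf : Summable fun p => f p ^ 2) (hD : Summable fun p => D p ^ 2) :
    Summable fun p => lapRow f p * D p := by
  have h0 : Summable fun p => f p * D p := summable_mul_of_sq hf hD
  have hplus : ∀ μ : Fin d, Summable fun p => f (p + e μ) * D p := fun μ =>
    summable_mul_of_sq (summable_sq_shift hf (e μ)) hD
  have hminus : ∀ μ : Fin d, Summable fun p => f (p - e μ) * D p := fun μ => by
    simpa [sub_eq_add_neg] using summable_mul_of_sq (summable_sq_shift hf (-e μ)) hD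
  have : (fun p => lapRow f p * D p) =
      fun p => ∑ μ : Fin d, (2 * (f p * D p) - f (p + e μ) * D p - f (p - e μ) * D p) := by
    funext p
    rw [lapRow, Finset.sum_mul]
    refine Finset.sum_congr rfl fun μ _ => ?_
    ring
  rw [this]
  exact summable_sum fun μ _ => ((h0.mul_left 2).sub (hplus μ)).sub (hminus μ)

/-- **Polarised summation by parts in `ℓ²(ℤ^d)`**: `⟨(−Δ)f, D⟩ = Σ_μ Σ_p (f(p) − f(p+e_μ))(D(p) − D(p+e_μ))`.
[folklore] -/
theorem tsum_lapRow_mul₂ {f D : X d → ℝ} (hf : Summable fun p => f p ^ 2) (hD : Summable fun p => D p ^ 2) :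
    ∑' p, lapRow f p * D p = ∑ μ : Fin d, ∑' p, (f p - f (p + e μ)) * (D p - D (p + e μ)) := by
  have h0 : Summable fun p => f p * D p := summable_mul_of_sq hf hD
  have hplus : ∀ μ : Fin d, Summable fun p => f (p + e μ) * D p := fun μ =>
    summable_mul_of_sq (summable_sq_shift hf (e μ)) hD
  have hplus' : ∀ μ : Fin d, Summable fun p => f p * D (p + e μ) := fun μ =>
    summable_mul_of_sq hf (summable_sq_shift hD (e μ))
  have hminus : ∀ μ : Fin d, Summable fun p => f (p - e μ) * D p := fun μ => by
    simpa [sub_eq_add_neg] using summable_mul_of_sq (summable_sq_shift hf (-e μ)) hD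
  have hboth : ∀ μ : Fin d, Summable fun p => f (p + e μ) * D (p + e μ) := fun μ =>
    summable_mul_of_sq (summable_sq_shift hf (e μ)) (summable_sq_shift hD (e μ))
  -- the shifted cross term: `Σ_p f(p − e)D(p) = Σ_p f(p)D(p + e)`
  have hshift : ∀ μ : Fin d, ∑' p, f (p - e μ) * D p = ∑' p, f p * D (p + e μ) := by
    intro μ
    rw [← tsum_addRight (F := fun p => f (p - e μ) * D p) (e μ)]
    simp only [add_sub_cancel_right]
  have hL : ∀ μ : Fin d, ∑' p, (2 * (f p * D p) - f (p + e μ) * D p - f (p - e μ) * D p) =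
      2 * ∑' p, f p * D p - ∑' p, f (p + e μ) * D p - ∑' p, f p * D (p + e μ) := by
    intro μ
    rw [((h0.mul_left 2).sub (hplus μ)).tsum_sub (hminus μ), (h0.mul_left 2).tsum_sub (hplus μ), tsum_mul_left,
      hshift μ]
  have hR : ∀ μ : Fin d, ∑' p, (f p - f (p + e μ)) * (D p - D (p + e μ)) =
      2 * ∑' p, f p * D p - ∑' p, f (p + e μ) * D p - ∑' p, f p * D (p + e μ) := by
    intro μ
    have hexp : (fun p => (f p - f (p + e μ)) * (D p - D (p + e μ))) =
        fun p => ((f p * D p - f p * D (p + e μ)) - f (p + e μ) * D p) + f (p + e μ) * D (p + e μ) := by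
      funext p; ring
    rw [hexp, ((h0.sub (hplus' μ)).sub (hplus μ)).tsum_add (hboth μ), (h0.sub (hplus' μ)).tsum_sub (hplus μ),
      h0.tsum_sub (hplus' μ), tsum_addRight (F := fun p => f p * D p) (e μ)]
    ring
  have hsplit : (fun p => lapRow f p * D p) =
      fun p => ∑ μ : Fin d, (2 * (f p * D p) - f (p + e μ) * D p - f (p - e μ) * D p) := by
    funext p
    rw [lapRow, Finset.sum_mul]
    refine Finset.sum_congr rfl fun μ _ => ?_
    ring
  rw [hsplit, Summable.tsum_finsetSum fun μ _ => ((h0.mul_left 2).sub (hplus μ)).sub (hminus μ)]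
  exact Finset.sum_congr rfl fun μ _ => by rw [hL μ, hR μ]

/-- **Pythagoras for the Dirichlet energy**: `energy (f + D) = energy f + energy D + 2⟨(−Δ)f, D⟩` for square-summable
`f`, `D`. [folklore] -/
theorem energy_add {f D : X d → ℝ} (hf : Summable fun p => f p ^ 2) (hD : Summable fun p => D p ^ 2) :
    energy (fun p => f p + D p) = energy f + energy D + 2 * ∑' p, lapRow f p * D p := by
  rw [tsum_lapRow_mul₂ hf hD, energy, energy, energy, Finset.mul_sum, ← Finset.sum_add_distrib,
    ← Finset.sum_add_distrib]
  refine Finset.sum_congr rfl fun μ _ => ?_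
  have h1 := summable_grad_sq hf μ
  have h2 := summable_grad_sq hD μ
  have h3 : Summable fun p => (f p - f (p + e μ)) * (D p - D (p + e μ)) :=
    summable_mul_of_sq h1 h2
  have hexp : (fun p => (f p + D p - (f (p + e μ) + D (p + e μ))) ^ 2) =
      fun p => ((f p - f (p + e μ)) ^ 2 + (D p - D (p + e μ)) ^ 2) +
        2 * ((f p - f (p + e μ)) * (D p - D (p + e μ))) := by
    funext p; ring
  rw [hexp, (h1.add h2).tsum_add (h3.mul_left 2), h1.tsum_add h2, tsum_mul_left]

/-! ## §4  A zero-energy square-summable block-mean-zero field vanishes [folklore] -/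

/-- A square-summable field with vanishing block sums that is invariant under every unit shift is zero
(`d ≥ 1`: square-summable sequences tend to `0` along the injective orbit `k ↦ p + k•e_μ₀`; `d = 0`: the single block).
[folklore] -/
theorem eq_zero_of_shift_eq {n : ℕ} {D : X d → ℝ} (hD2 : Summable fun p => D p ^ 2) (hQ : BlockMeanZero n D)
    (hshift : ∀ (μ : Fin d) (p : X d), D (p + e μ) = D p) (p : X d) : D p = 0 := by
  rcases Nat.eq_zero_or_pos d with hd | hd
  · subst hd
    have hB := hQ (blk n p)
    rw [sum_B, Fintype.sum_unique] at hB
    have hc : ∀ z : Fin 0 → Fin (n + 1), chart n (blk n p) z = p := fun z => Subsingleton.elim _ _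
    rwa [hc] at hB
  · set μ₀ : Fin d := ⟨0, hd⟩
    set orb : ℕ → X d := fun k => p + (k : ℤ) • e μ₀ with horb
    have hconst : ∀ k : ℕ, D (orb k) = D p := by
      intro k
      induction k with
      | zero => simp [horb]
      | succ k ih =>
        have : orb (k + 1) = orb k + e μ₀ := by
          simp only [horb]; push_cast; rw [add_smul, one_smul, add_assoc]
        rw [this, hshift μ₀ (orb k), ih]
    have hinj : Function.Injective orb := by
      intro k₁ k₂ hk
      have := congr_fun hk μ₀
      simp only [horb, Pi.add_apply, Pi.smul_apply, e, Pi.single_eq_same, smul_eq_mul, mul_one,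
        add_right_inj] at this
      exact_mod_cast this
    have ht : Tendsto (fun k => D (orb k) ^ 2) cofinite (𝓝 0) :=
      hD2.tendsto_cofinite_zero.comp hinj.tendsto_cofinite
    simp only [hconst] at ht
    exact pow_eq_zero_iff (n := 2) (by norm_num) |>.1 (tendsto_const_nhds_iff.1 ht)

/-- A square-summable field with vanishing block sums and ZERO ENERGY vanishes. [folklore] -/
theorem eq_zero_of_energy_eq_zero {n : ℕ} {D : X d → ℝ} (hD2 : Summable fun p => D p ^ 2)
    (hQ : BlockMeanZero n D) (hE : energy D = 0) (p : X d) : D p = 0 := by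
  refine eq_zero_of_shift_eq hD2 hQ (fun μ q => ?_) p
  have hμ : ∑' q, (D q - D (q + e μ)) ^ 2 = 0 :=
    (Finset.sum_eq_zero_iff_of_nonneg fun ν _ => tsum_nonneg fun q => sq_nonneg _).1 hE μ (Finset.mem_univ μ)
  by_contra hne
  have hpos : 0 < (D q - D (q + e μ)) ^ 2 := by
    have : D q - D (q + e μ) ≠ 0 := sub_ne_zero.2 (Ne.symm hne)
    positivity
  have := (summable_grad_sq hD2 μ).tsum_pos (fun q => sq_nonneg _) q hpos
  linarith

/-! ## §5  `HB`: block sums, square-summability, and the Euler–Lagrange identity [folklore; print-located] -/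

/-- `Q'(HB) = B`: `Σ_{p∈B(y'')} (HB)(p) = (n+1)^d B(y'')` for `B` supported in `T`.
[cite: Balaban1984PropagatorsI, p.29 after (1.63)] -/
theorem sum_B_HB (n : ℕ) {a : ℝ} (ha : 0 < a) (T : Finset (X d)) (Bf : X d → ℝ) (hT : ∀ y ∉ T, Bf y = 0)
    (y'' : X d) : ∑ p ∈ B n y'', HB n a T Bf p = ((n : ℝ) + 1) ^ d * Bf y'' := by
  classical
  simp only [HB]
  rw [Finset.sum_comm]
  simp_rw [← Finset.mul_sum, sum_B_kerH n ha]
  rw [Finset.sum_congr rfl fun y _ => show Bf y * (((n : ℝ) + 1) ^ d * if y'' = y then (1 : ℝ) else 0) =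
      if y'' = y then ((n : ℝ) + 1) ^ d * Bf y else 0 by split_ifs <;> ring]
  rw [Finset.sum_ite_eq]
  split_ifs with hy
  · rfl
  · rw [hT y'' hy, mul_zero]

/-- `HB ∈ ℓ²(ℤ^d)`. [folklore] -/
theorem summable_HB_sq (n : ℕ) {a : ℝ} (ha : 0 < a) (T : Finset (X d)) (Bf : X d → ℝ) :
    Summable fun p => HB n a T Bf p ^ 2 := by
  classical
  simp only [HB]
  induction T using Finset.induction_on with
  | empty => simp
  | insert y T hy ih =>
    simp only [Finset.sum_insert hy]
    exact summable_sq_add (summable_sq_smul (Bf y) (summable_kerH_sq n ha y)) ih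

/-- `lapRow` of a column of `H`: `((−Δ)H(·,y))(p) = ((Q'G'Q'*)⁻¹(blk p, y) − a δ_{blk p, y}) / (n+1)²`
(`B5Hk103ScalarZd.tsum_lap_mul_kerH`, the Euler–Lagrange identity) — constant on blocks.
[cite: Balaban1984PropagatorsI, p.29 after (1.63)] -/
theorem lapRow_kerH (n : ℕ) {a : ℝ} (ha : 0 < a) (p y : X d) :
    lapRow (fun r => kerH n a r y) p =
      (Kinv n a (blk n p) y - a * (if blk n p = y then 1 else 0)) / ((n : ℝ) + 1) ^ 2 := by
  have hc : ((n : ℝ) + 1) ^ 2 ≠ 0 := by positivity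
  rw [eq_div_iff hc, ← tsum_lap_mul_kerH n ha p y, lapRow, ← tsum_lapKer_mul p (fun r => kerH n a r y),
    mul_comm, ← tsum_mul_left]
  exact tsum_congr fun r => by ring

/-- `lapRow` is additive. [folklore] -/
theorem lapRow_add (f g : X d → ℝ) (p : X d) : lapRow (fun r => f r + g r) p = lapRow f p + lapRow g p := by
  simp only [lapRow, ← Finset.sum_add_distrib]
  exact Finset.sum_congr rfl fun μ _ => by ring

/-- `lapRow` is homogeneous. [folklore] -/
theorem lapRow_smul (c : ℝ) (f : X d → ℝ) (p : X d) : lapRow (fun r => c * f r) p = c * lapRow f p := by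
  simp only [lapRow, Finset.mul_sum]
  exact Finset.sum_congr rfl fun μ _ => by ring

/-- `lapRow` of a finite sum of columns. [folklore] -/
theorem lapRow_HB (n : ℕ) {a : ℝ} (ha : 0 < a) (T : Finset (X d)) (Bf : X d → ℝ) (p : X d) :
    lapRow (HB n a T Bf) p =
      ∑ y ∈ T, Bf y * ((Kinv n a (blk n p) y - a * (if blk n p = y then 1 else 0)) / ((n : ℝ) + 1) ^ 2) := by
  classical
  induction T using Finset.induction_on with
  | empty => simp [HB, lapRow]
  | insert y T hy ih =>
    have hfun : HB n a (insert y T) Bf = fun r => Bf y * kerH n a r y + HB n a T Bf r := by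
      funext r; simp [HB, Finset.sum_insert hy]
    rw [hfun, lapRow_add, lapRow_smul, lapRow_kerH n ha, Finset.sum_insert hy, ih]

/-- **The Euler–Lagrange identity kills the cross term**: `⟨(−Δ)HB, D⟩ = 0` for every square-summable `D` with
`Q'D = 0` (`(−Δ)HB` is block-constant; sum block by block). [cite: Balaban1984PropagatorsI, p.29 after (1.63)] -/
theorem tsum_lapRow_HB_mul_eq_zero (n : ℕ) {a : ℝ} (ha : 0 < a) (T : Finset (X d)) (Bf : X d → ℝ)
    {D : X d → ℝ} (hD2 : Summable fun p => D p ^ 2) (hQ : BlockMeanZero n D) :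
    ∑' p, lapRow (HB n a T Bf) p * D p = 0 := by
  classical
  set φ : X d → ℝ := fun y'' =>
    ∑ y ∈ T, Bf y * ((Kinv n a y'' y - a * (if y'' = y then 1 else 0)) / ((n : ℝ) + 1) ^ 2) with hφ
  have hconst : ∀ p, lapRow (HB n a T Bf) p = φ (blk n p) := fun p => lapRow_HB n ha T Bf p
  have hsum : Summable fun p => lapRow (HB n a T Bf) p * D p :=
    summable_lapRow_mul₂ (summable_HB_sq n ha T Bf) hD2
  rw [← tsum_blocks n hsum]
  have hblock : ∀ y, ∑ q ∈ B n y, lapRow (HB n a T Bf) q * D q = φ y * ∑ q ∈ B n y, D q := by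
    intro y
    rw [Finset.mul_sum]
    refine Finset.sum_congr rfl fun q hq => ?_
    rw [hconst q, mem_B.1 hq]
  have hQ' : ∀ y, ∑ q ∈ B n y, D q = 0 := hQ
  simp only [hblock, hQ', mul_zero, tsum_zero]

/-! ## §6  Global minimality and uniqueness of the minimiser [print-located; scalar analogue proved outright] -/

/-- **PYTHAGORAS on the hyperplane `{Q'A = B}`**: for every competitor `A` with `Q'A = B` and `A − HB ∈ ℓ²`,
`energy A = energy HB + energy (A − HB)`. [cite: Balaban1984PropagatorsI, p.29 after (1.63)] -/
theorem energy_eq_add (n : ℕ) {a : ℝ} (ha : 0 < a) (T : Finset (X d)) (Bf : X d → ℝ) (hT : ∀ y ∉ T, Bf y = 0)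
    (A : X d → ℝ) (hA2 : Summable fun p => (A p - HB n a T Bf p) ^ 2)
    (hAQ : ∀ y'' : X d, ∑ p ∈ B n y'', A p = ((n : ℝ) + 1) ^ d * Bf y'') :
    energy A = energy (HB n a T Bf) + energy (fun p => A p - HB n a T Bf p) := by
  have hQD : BlockMeanZero n fun p => A p - HB n a T Bf p :=
    blockMeanZero_sub (fun y'' => ((n : ℝ) + 1) ^ d * Bf y'') hAQ (sum_B_HB n ha T Bf hT)
  have hsplit : A = fun p => HB n a T Bf p + (A p - HB n a T Bf p) := by
    funext p; ring
  conv_lhs => rw [hsplit]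
  rw [energy_add (summable_HB_sq n ha T Bf) hA2, tsum_lapRow_HB_mul_eq_zero n ha T Bf hA2 hQD, mul_zero, add_zero]

/-- **GLOBAL MINIMALITY** («H_kB is a minimum of ½⟨∂A, ∂A⟩ on the hyperplane {A : Q_kA = B, …}», scalar, `ℤ^d`,
`ℓ²`-difference class): `energy HB ≤ energy A`. [cite: Balaban1984PropagatorsI, p.29 after (1.63)] -/
theorem energy_HB_le (n : ℕ) {a : ℝ} (ha : 0 < a) (T : Finset (X d)) (Bf : X d → ℝ) (hT : ∀ y ∉ T, Bf y = 0)
    (A : X d → ℝ) (hA2 : Summable fun p => (A p - HB n a T Bf p) ^ 2)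
    (hAQ : ∀ y'' : X d, ∑ p ∈ B n y'', A p = ((n : ℝ) + 1) ^ d * Bf y'') :
    energy (HB n a T Bf) ≤ energy A := by
  rw [energy_eq_add n ha T Bf hT A hA2 hAQ]
  have : 0 ≤ energy (fun p => A p - HB n a T Bf p) :=
    Finset.sum_nonneg fun μ _ => tsum_nonneg fun p => sq_nonneg _
  linarith

/-- **UNIQUENESS OF THE MINIMISER**: a competitor in the class with the same energy IS `HB`.
[cite: Balaban1984PropagatorsI, p.29 after (1.63)] -/
theorem eq_HB_of_energy_eq (n : ℕ) {a : ℝ} (ha : 0 < a) (T : Finset (X d)) (Bf : X d → ℝ)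
    (hT : ∀ y ∉ T, Bf y = 0) (A : X d → ℝ) (hA2 : Summable fun p => (A p - HB n a T Bf p) ^ 2)
    (hAQ : ∀ y'' : X d, ∑ p ∈ B n y'', A p = ((n : ℝ) + 1) ^ d * Bf y'')
    (hE : energy A = energy (HB n a T Bf)) : A = HB n a T Bf := by
  funext p
  have hQD : BlockMeanZero n fun p => A p - HB n a T Bf p :=
    blockMeanZero_sub (fun y'' => ((n : ℝ) + 1) ^ d * Bf y'') hAQ (sum_B_HB n ha T Bf hT)
  have hE0 : energy (fun p => A p - HB n a T Bf p) = 0 := by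
    have := energy_eq_add n ha T Bf hT A hA2 hAQ
    linarith
  have := eq_zero_of_energy_eq_zero hA2 hQD hE0 p
  linarith

/-- Strict form: any OTHER competitor in the class has strictly larger energy. [folklore] -/
theorem energy_HB_lt (n : ℕ) {a : ℝ} (ha : 0 < a) (T : Finset (X d)) (Bf : X d → ℝ) (hT : ∀ y ∉ T, Bf y = 0)
    (A : X d → ℝ) (hA2 : Summable fun p => (A p - HB n a T Bf p) ^ 2)
    (hAQ : ∀ y'' : X d, ∑ p ∈ B n y'', A p = ((n : ℝ) + 1) ^ d * Bf y'') (hne : A ≠ HB n a T Bf) :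
    energy (HB n a T Bf) < energy A :=
  lt_of_le_of_ne (energy_HB_le n ha T Bf hT A hA2 hAQ)
    fun h => hne (eq_HB_of_energy_eq n ha T Bf hT A hA2 hAQ h.symm)

/-! ## §7  The point source `B = δ_y`: the column `H(·,y)` [folklore] -/

/-- For `B = δ_y` (`T = {y}`, `B ≡ 1` there), `HB = H(·,y)`. [folklore] -/
theorem HB_single (n : ℕ) (a : ℝ) (y : X d) : HB n a {y} (fun _ => 1) = fun p => kerH n a p y := by
  funext p; simp [HB]

/-- **The column `H(·,y)` minimises the energy among all fields `A` with `Q'A = δ_y` (block sums `(n+1)^d δ_{y''y}`)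
and `A − H(·,y) ∈ ℓ²`, uniquely.** [cite: Balaban1984PropagatorsI, p.29 after (1.63)] -/
theorem energy_kerH_col_le (n : ℕ) {a : ℝ} (ha : 0 < a) (y : X d) (A : X d → ℝ)
    (hA2 : Summable fun p => (A p - kerH n a p y) ^ 2)
    (hAQ : ∀ y'' : X d, ∑ p ∈ B n y'', A p = ((n : ℝ) + 1) ^ d * (if y'' = y then 1 else 0)) :
    energy (fun p => kerH n a p y) ≤ energy A ∧
      (energy A = energy (fun p => kerH n a p y) → A = fun p => kerH n a p y) := by
  classical
  have hT : ∀ y' ∉ ({y} : Finset (X d)), (fun y' : X d => if y' = y then (1 : ℝ) else 0) y' = 0 := by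
    intro y' hy'
    simp only [Finset.mem_singleton] at hy'
    simp [hy']
  have hHB : HB n a {y} (fun y' => if y' = y then (1 : ℝ) else 0) = fun p => kerH n a p y := by
    funext p; simp [HB]
  have hA2' : Summable fun p => (A p - HB n a {y} (fun y' => if y' = y then (1 : ℝ) else 0) p) ^ 2 := by
    simpa [hHB] using hA2
  have hAQ' : ∀ y'' : X d, ∑ p ∈ B n y'', A p =
      ((n : ℝ) + 1) ^ d * (fun y' : X d => if y' = y then (1 : ℝ) else 0) y'' := fun y'' => by
    simpa using hAQ y''
  refine ⟨?_, fun hE => ?_⟩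
  · have := energy_HB_le n ha {y} _ hT A hA2' hAQ'
    rwa [hHB] at this
  · have := eq_HB_of_energy_eq n ha {y} _ hT A hA2' hAQ' (by rw [hHB]; exact hE)
    rwa [hHB] at this

/-! ## §8  `HB` as the unique weak solution (Euler–Lagrange form, cf. `B5Hk103Unique`) [folklore; print-located] -/

/-- The weak Euler–Lagrange equation is preserved under scalar multiples. [folklore] -/
theorem weakEL_smul {n : ℕ} {D : X d → ℝ} (c : ℝ) (h : WeakEL n D) : WeakEL n fun p => c * D p := by
  intro S A' hS hQ
  have : (fun p => (∑ r ∈ S, ((n : ℝ) + 1) ^ 2 * lapKer p r * A' r) * (c * D p)) =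
      fun p => c * ((∑ r ∈ S, ((n : ℝ) + 1) ^ 2 * lapKer p r * A' r) * D p) := by
    funext p; ring
  rw [this, tsum_mul_left, h S A' hS hQ, mul_zero]

/-- The weak Euler–Lagrange equation is preserved under sums. [folklore] -/
theorem weakEL_add {n : ℕ} {D₁ D₂ : X d → ℝ} (h₁ : WeakEL n D₁) (h₂ : WeakEL n D₂) :
    WeakEL n fun p => D₁ p + D₂ p := by
  intro S A' hS hQ
  simp only [mul_add]
  rw [(summable_testRow_mul n S A' D₁).tsum_add (summable_testRow_mul n S A' D₂), h₁ S A' hS hQ, h₂ S A' hS hQ,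
    add_zero]

/-- `HB` satisfies the weak Euler–Lagrange equation («⟨∂A′, ∂H_kB⟩ = 0 on the subspace {A′ : Q_kA′ = 0, …}», scalar,
`ℤ^d`; from `B5Hk103ScalarZd.weakEL_kerH` by linearity). [cite: Balaban1984PropagatorsI, p.29 after (1.63)] -/
theorem weakEL_HB (n : ℕ) {a : ℝ} (ha : 0 < a) (T : Finset (X d)) (Bf : X d → ℝ) : WeakEL n (HB n a T Bf) := by
  classical
  induction T using Finset.induction_on with
  | empty =>
    intro S A' hS hQ
    simp [HB]
  | insert y T hy ih =>
    have hfun : HB n a (insert y T) Bf = fun r => Bf y * kerH n a r y + HB n a T Bf r := by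
      funext r; simp [HB, Finset.sum_insert hy]
    rw [hfun]
    exact weakEL_add (weakEL_smul (Bf y) (weakEL_kerH_col n ha y)) ih

/-- **`HB` is the unique square-summable weak solution**: a square-summable field `K` with `Q'K = B` satisfying the
weak Euler–Lagrange equation IS `HB` (`B5Hk103Unique.eq_zero_of_weakEL` applied to `K − HB`).
[cite: Balaban1984PropagatorsI, p.29 after (1.63)] -/
theorem eq_HB_of_weakEL (n : ℕ) {a : ℝ} (ha : 0 < a) (T : Finset (X d)) (Bf : X d → ℝ) (hT : ∀ y ∉ T, Bf y = 0)
    (K : X d → ℝ) (hK2 : Summable fun p => K p ^ 2)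
    (hKQ : ∀ y'' : X d, ∑ p ∈ B n y'', K p = ((n : ℝ) + 1) ^ d * Bf y'') (hKEL : WeakEL n K) :
    K = HB n a T Bf := by
  funext p
  have h := eq_zero_of_weakEL (summable_sq_sub hK2 (summable_HB_sq n ha T Bf))
    (blockMeanZero_sub (fun y'' => ((n : ℝ) + 1) ^ d * Bf y'') hKQ (sum_B_HB n ha T Bf hT))
    (weakEL_sub hKEL (weakEL_HB n ha T Bf)) p
  linarith

end

end Literature.MathematicalPhysics.QuantumFieldTheory.Balaban1983to89.B5Hk103Minimizer
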